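import Literature.Probability.RandomPlanarGeometry.HexSAWRotTourKeyIneq
import Literature.Probability.RandomPlanarGeometry.SAWBlockLogDecay
import Literature.Probability.RandomPlanarGeometry.HexSAWBrickWallBridgeNullBeaton
import Mathlib.Analysis.SpecialFunctions.Pow.Real
import Mathlib.Analysis.SpecialFunctions.Log.Basic
import HarnessLib

/-!
# Logarithmic decay of Beaton's rotated-strip bridge generating function and Beaton's Theorem 14 with a rate

Topic `Literature/Probability/RandomPlanarGeometry`; lane «pcv-sawmu», door R95 «HEX-BW-GM-ROT» (planner a-idea-1,
typed layer `Sketch_G16_K954.lean` e4e31e90a0589e7a, rebased editions G17d/G17e; tree edition split by prover a-p6 g7,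
statements token-identical to the HOME kernel text G17e 1637ea746fc4e499 unless said in the file header).
Sources: A. Glazman, I. Manolescu, *Self-avoiding walk on ℤ² with Yang–Baxter weights: universality of critical
fugacity and 2-point function* (arXiv:1708.00395; AIHP 2020), §4.1, Lemma 4.1 and Proposition 1.1 (the three
rotated triangles and the block inequality); N. R. Beaton, *The critical surface fugacity of self-avoiding walks on a
rotated honeycomb lattice*, J. Phys. A 47 (2014) 075003 (arXiv:1210.0274v3), §2.2, Proposition 4, Appendix Thm 14.

SECTION 1 (Parts A, C and the assembly of the HOME text, plus the dictionary to the brick-wall frame): the abstract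
log-rate lemma `RotGM.logRate_of_blocks` (instance `a = 4, b = 0` of the tree's `SAW.antitone_le_log_rpow_of_blocks`);
the block package `RotTriangleBlocks` over `W := rotTriW` (nonnegative, `≤ K/2`, antitone, block inequality K95.4,
comparison `rotStripBR H W ≤ W_M` for `6M+2 ≤ H`, uniform bound) = `rotTriangleBlocks_holds`; **THM A**
`rotStripLogDecay_holds : ∃ C, ∀ H ≥ 2, ∀ W, rotStripBR H W ≤ C · (log H)^{-1/3}` — Beaton's rotated-strip bridge
generating function at `x_c` decays with a RATE, uniformly in the width (Beaton 2014 App. Thm 14 has `→ 0` only);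
via the tree's dictionary `HexBW.rot_dictionary` the brick-wall span generating functions obey
`spanDecayLog_holds : ∃ C, ∀ A ≥ 2, bwSpanV A = Σ_m #spanBridges(m, A) μ^{-m} ≤ C (log A)^{-1/3}` (face `SpanDecayLog`
stated over the tree's `bwSpanV`); hence Beaton's NAMED FACT `HexBW.Beaton2014Thm14` (`PP_T(x_c) → 0`, tree file
`HexSAWBrickWallBridgeNullBeaton`) is DISCHARGED (`beaton2014Thm14_holds`), and the perpendicular-frame bridge null
`b_n(ℍ)/μ^n → 0` (`tendsto_bridgeCount_div_pow_zero`) becomes unconditional.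
-/

noncomputable section

open Finset Filter Topology
open scoped BigOperators


/-! ## Section: HexSAWRotStripLogDecay -/

namespace Literature.Probability.RandomPlanarGeometry.SAW

/-! ## The abstract analytic tail: block inequality ⇒ logarithmic rate -/

namespace RotGM

/-- **Block inequality ⇒ logarithmic rate.** If `W ≥ 0` is antitone, bounded by `Wmax`, and
`(m+1) · W(4 r^m)^3 ≤ A` for every `m` (`r ≥ 2`), then `W N ≤ C (log N)^{-1/3}` for all `N ≥ 2`, for some
`C ≥ 0` (explicitly `C = max (Wmax · (log (16 r²))^{1/3}) ((2 A log r)^{1/3})`: the instance `a = 4`, `b = 0`, `q = r`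
of the tree's `SAW.antitone_le_log_rpow_of_blocks`). Glazman–Manolescu's bookkeeping "`Σ_k (D_{4·9^k})³ < ∞` and `D`
decreasing ⇒ `D_T ≤ C (log T)^{-1/3}`", abstracted. [cite: GlazmanManolescu2019, §4.1 (proof of Proposition 1.1)] -/
theorem logRate_of_blocks {W : ℕ → ℝ} {A Wmax : ℝ} {r : ℕ} (hr : 2 ≤ r)
    (hW0 : ∀ n, 0 ≤ W n) (hWmax : ∀ n, W n ≤ Wmax) (hanti : Antitone W)
    (hA : 0 ≤ A) (hblock : ∀ m : ℕ, ((m : ℝ) + 1) * W (4 * r ^ m) ^ 3 ≤ A) :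
    ∃ C : ℝ, 0 ≤ C ∧ ∀ N : ℕ, 2 ≤ N → W N ≤ C * Real.log N ^ (-(1 : ℝ) / 3) := by
  have hblock' : ∀ m : ℕ, ((m : ℝ) + 1) * W (4 * r ^ m + 0) ^ 3 ≤ A := fun m => by
    simpa only [add_zero] using hblock m
  have hr1 : (1 : ℝ) ≤ r := by exact_mod_cast (by omega : 1 ≤ r)
  have h := antitone_le_log_rpow_of_blocks hanti hW0 hWmax (a := 4) (b := 0) (q := r) (by norm_num) hr hA hblock'
  exact ⟨_, le_max_of_le_right (Real.rpow_nonneg (mul_nonneg (mul_nonneg zero_le_two hA) (Real.log_nonneg hr1)) _), h⟩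

end RotGM

namespace HV

/-- One of Beaton's coefficient inequalities for `2sin(π/16), 2sin(3π/16), 2cos(π/16), 2cos(3π/16), 2cos(7π/16)` (elementary trigonometry). [cite: Beaton2014RotatedHoneycomb, Proposition 4 (the coefficients)] -/
private theorem cO_posC : 0 < 2 * Real.sin (3 * Real.pi / 16) := by
  have := Real.sin_pos_of_pos_of_lt_pi (x := 3 * Real.pi / 16) (by positivity) (by linarith [Real.pi_pos])
  linarith
/-- One of Beaton's coefficient inequalities for `2sin(π/16), 2sin(3π/16), 2cos(π/16), 2cos(3π/16), 2cos(7π/16)` (elementary trigonometry). [cite: Beaton2014RotatedHoneycomb, Proposition 4 (the coefficients)] -/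
private theorem cI_posC : 0 < 2 * Real.sin (Real.pi / 16) := by
  have := Real.sin_pos_of_pos_of_lt_pi (x := Real.pi / 16) (by positivity) (by linarith [Real.pi_pos])
  linarith
/-- One of Beaton's coefficient inequalities for `2sin(π/16), 2sin(3π/16), 2cos(π/16), 2cos(3π/16), 2cos(7π/16)` (elementary trigonometry). [cite: Beaton2014RotatedHoneycomb, Proposition 4 (the coefficients)] -/
private theorem cE_posC : 0 < 2 * Real.cos (3 * Real.pi / 16) := by
  have := Real.cos_pos_of_mem_Ioo (x := 3 * Real.pi / 16) ⟨by linarith [Real.pi_pos], by linarith [Real.pi_pos]⟩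
  linarith
/-- One of Beaton's coefficient inequalities for `2sin(π/16), 2sin(3π/16), 2cos(π/16), 2cos(3π/16), 2cos(7π/16)` (elementary trigonometry). [cite: Beaton2014RotatedHoneycomb, Proposition 4 (the coefficients)] -/
private theorem cB_posC : 0 < 2 * Real.cos (Real.pi / 16) := by
  have := Real.cos_pos_of_mem_Ioo (x := Real.pi / 16) ⟨by linarith [Real.pi_pos], by linarith [Real.pi_pos]⟩
  linarith
/-- One of Beaton's coefficient inequalities for `2sin(π/16), 2sin(3π/16), 2cos(π/16), 2cos(3π/16), 2cos(7π/16)` (elementary trigonometry). [cite: Beaton2014RotatedHoneycomb, Proposition 4 (the coefficients)] -/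
private theorem cB_ge_oneC : 1 ≤ 2 * Real.cos (Real.pi / 16) := by
  have h := Real.cos_le_cos_of_nonneg_of_le_pi (x := Real.pi / 16) (y := Real.pi / 3)
    (by positivity) (by linarith [Real.pi_pos]) (by linarith [Real.pi_pos])
  rw [Real.cos_pi_div_three] at h
  linarith
/-- One of Beaton's coefficient inequalities for `2sin(π/16), 2sin(3π/16), 2cos(π/16), 2cos(3π/16), 2cos(7π/16)` (elementary trigonometry). [cite: Beaton2014RotatedHoneycomb, Proposition 4 (the coefficients)] -/
private theorem cP_posC : 0 < 2 * Real.cos (7 * Real.pi / 16) := by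
  have := Real.cos_pos_of_mem_Ioo (x := 7 * Real.pi / 16) ⟨by linarith [Real.pi_pos], by linarith [Real.pi_pos]⟩
  linarith

/-- uniform bound `B^{⊥,→}_{D(H,W)} ≤ K/2 = 2 x_c cos(π/16)` (all widths; from the strip identity, every other class being nonnegative and `c_B ≥ 1`). [cite: Beaton2014RotatedHoneycomb, Proposition 4] -/
theorem rotStripBR_le_K {H : ℕ} (hH : 1 ≤ H) (Wd : ℕ) :
    rotStripBR H Wd ≤ 2 * hexCriticalFugacity * Real.cos (Real.pi / 16) := by
  have key : ∀ Wd', 1 ≤ Wd' → rotStripBR H Wd' ≤ 2 * hexCriticalFugacity * Real.cos (Real.pi / 16) := by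
    intro Wd' hWd'
    have e1 := rotStrip_identity hH hWd'
    rw [rotStripBR_eq_rotGF]
    set V := (rotStripV H Wd').erase wOut
    have hB := rotGF_nonneg V (IsRotTopDart H)
    have hB' : rotGF V (IsRotTopDart H) ≤ 2 * Real.cos (Real.pi / 16) * rotGF V (IsRotTopDart H) :=
      le_mul_of_one_le_left hB cB_ge_oneC
    linarith [mul_nonneg cO_posC.le (rotGF_nonneg V IsRotBotOut), mul_nonneg cI_posC.le (rotGF_nonneg V IsRotBotIn),
      mul_nonneg cP_posC.le (rotGF_nonneg V IsRotCloseDart), mul_nonneg cE_posC.le (rotGF_nonneg V (IsRotLatDart H Wd'))]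
  rcases Nat.eq_zero_or_pos Wd with rfl | hpos
  · exact (rotStripBR_mono_width (Nat.zero_le 1)).trans (key 1 le_rfl)
  · exact key Wd hpos

/-- FACE K95.7 = THM A (right-started half; the full `B_{T,L}` is twice this): Beaton's rotated strip
bridge partition function decays logarithmically, uniformly in the width.
NOT IN PRINT in the rotated (perpendicular) frame (Beaton 2014 App. Thm 14 / Cor. 15: `→ 0` without rate; the PARALLEL frame has
Glazman–Manolescu 2020 Prop. 1.1 and Krachun–Panagiotis 2026 Thm 2, `B_T ≤ 100·T^{-10^{-10}}`, tree `HV.hexBridgeLogDecay`).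
[cite: Beaton2014RotatedHoneycomb, Appendix Theorem 14; GlazmanManolescu2019, Proposition 1.1; KrachunPanagiotis2026, Theorem 2] -/
def RotStripLogDecay : Prop :=
  ∃ C : ℝ, ∀ H : ℕ, 2 ≤ H → ∀ Wd : ℕ, rotStripBR H Wd ≤ C * Real.log H ^ (-(1 : ℝ) / 3)

/-- FACES K95.3 + K95.5 packaged (S2–S5 of ROUTES-G15 §2.3) over the rotated-triangle functional
`W_M = c_E D^ε_M + c_B D^β_M`: it is nonnegative, bounded by `K = 4 x_c cos(π/16)`, ANTITONE (nesting of
the triangles `T_M` with the same `a`), satisfies the BLOCK INEQUALITY from the rotated GM tour with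
ratio-20 blocks, and dominates the strip: `B^{⊥,→}_{H,W} ≤ W_M` once `T_M ⊂ D(H,W)` up to width-monotonicity
(`H ≥ 6M + 2`); last conjunct = the uniform bound `B ≤ K/c_B` of Prop 4 (S1). The existential hides the
concrete `W` (to be DEFINED by the prover from the rotated triangles `T_M`).
[cite: GlazmanManolescu2019, Lemma 4.1 and §4.1; Beaton2014RotatedHoneycomb, Proposition 4] -/
def RotTriangleBlocks : Prop :=
  ∃ (W : ℕ → ℝ) (A Wmax : ℝ), (∀ n, 0 ≤ W n) ∧ (∀ n, W n ≤ Wmax) ∧ Antitone W ∧ 0 ≤ A ∧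
    (∀ m : ℕ, ((m : ℝ) + 1) * W (4 * 20 ^ m) ^ 3 ≤ A) ∧
    (∀ M H Wd : ℕ, 1 ≤ M → 6 * M + 2 ≤ H → rotStripBR H Wd ≤ W M) ∧
    (∀ H Wd : ℕ, 1 ≤ H → rotStripBR H Wd ≤ Wmax)

/-- PROVED GLUE: `RotTriangleBlocks → RotStripLogDecay` — `RotGM.logRate_of_blocks` with `r = 20`,
then `M(H) = ⌊(H-2)/6⌋` and `log M ≥ ½ log H` for `H ≥ 64`; the range `H < 64` by the uniform bound.
[cite: GlazmanManolescu2019, §4.1] -/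
theorem rotStripLogDecay_of_blocks (h : RotTriangleBlocks) : RotStripLogDecay := by
  obtain ⟨W, A, Wmax, hW0, hWmax, hanti, hA, hblock, hcomp, hbdd⟩ := h
  obtain ⟨C₁, hC₁0, hC₁⟩ :=
    RotGM.logRate_of_blocks (r := 20) (by norm_num) hW0 hWmax hanti hA hblock
  have hWmax0 : 0 ≤ Wmax := (hW0 0).trans (hWmax 0)
  have hlog64 : 0 < Real.log 64 := Real.log_pos (by norm_num)
  have h64r : 0 ≤ Real.log 64 ^ ((1 : ℝ) / 3) := Real.rpow_nonneg hlog64.le _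
  have h2r : 0 ≤ (2 : ℝ) ^ ((1 : ℝ) / 3) := Real.rpow_nonneg zero_le_two _
  refine ⟨C₁ * (2 : ℝ) ^ ((1 : ℝ) / 3) + Wmax * Real.log 64 ^ ((1 : ℝ) / 3), fun H hH Wd => ?_⟩
  have hH1 : (1 : ℝ) < H := by exact_mod_cast (by omega : 1 < H)
  have hlogH : 0 < Real.log H := Real.log_pos hH1
  have hy0 : 0 ≤ Real.log H ^ (-(1 : ℝ) / 3) := Real.rpow_nonneg hlogH.le _
  rcases Nat.lt_or_ge H 64 with hH64 | hH64
  · have hle : Real.log H ≤ Real.log 64 :=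
      Real.log_le_log (by positivity) (by exact_mod_cast (by omega : H ≤ 64))
    have hmono : Real.log 64 ^ (-(1 : ℝ) / 3) ≤ Real.log H ^ (-(1 : ℝ) / 3) :=
      Real.rpow_le_rpow_of_nonpos hlogH hle (by norm_num)
    have hone : Real.log 64 ^ ((1 : ℝ) / 3) * Real.log 64 ^ (-(1 : ℝ) / 3) = 1 := by
      rw [← Real.rpow_add hlog64]; norm_num
    calc rotStripBR H Wd ≤ Wmax := hbdd H Wd (by omega)
      _ = Wmax * (Real.log 64 ^ ((1 : ℝ) / 3) * Real.log 64 ^ (-(1 : ℝ) / 3)) := by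
          rw [hone, mul_one]
      _ ≤ Wmax * (Real.log 64 ^ ((1 : ℝ) / 3) * Real.log H ^ (-(1 : ℝ) / 3)) :=
          mul_le_mul_of_nonneg_left (mul_le_mul_of_nonneg_left hmono h64r) hWmax0
      _ = Wmax * Real.log 64 ^ ((1 : ℝ) / 3) * Real.log H ^ (-(1 : ℝ) / 3) := by ring
      _ ≤ _ := by nlinarith [mul_nonneg (mul_nonneg hC₁0 h2r) hy0]
  · set M : ℕ := (H - 2) / 6 with hM
    have hM10 : 10 ≤ M := by omega
    have hMH : 6 * M + 2 ≤ H := by omega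
    have hHM : H < 6 * M + 8 := by omega
    have hMM : H < M * M := by nlinarith [Nat.mul_le_mul_right M hM10]
    have hcmp : rotStripBR H Wd ≤ W M := hcomp M H Wd (by omega) hMH
    have hWM : W M ≤ C₁ * Real.log M ^ (-(1 : ℝ) / 3) := hC₁ M (by omega)
    have hM1 : (1 : ℝ) < M := by exact_mod_cast (by omega : 1 < M)
    have hlogM : 0 < Real.log M := Real.log_pos hM1
    have hlogHM : Real.log H ≤ 2 * Real.log M := by
      have h0 : H ≤ M ^ 2 := by rw [sq]; exact hMM.le
      have h1 : (H : ℝ) ≤ (M : ℝ) ^ 2 := by exact_mod_cast h0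
      have h2 := Real.log_le_log (by positivity) h1
      rw [Real.log_pow] at h2
      push_cast at h2
      linarith
    have hhalf : Real.log H / 2 ≤ Real.log M := by linarith
    have hmono : Real.log M ^ (-(1 : ℝ) / 3) ≤ (Real.log H / 2) ^ (-(1 : ℝ) / 3) :=
      Real.rpow_le_rpow_of_nonpos (half_pos hlogH) hhalf (by norm_num)
    have hsplit : (Real.log H / 2) ^ (-(1 : ℝ) / 3) =
        (2 : ℝ) ^ ((1 : ℝ) / 3) * Real.log H ^ (-(1 : ℝ) / 3) := by
      rw [Real.div_rpow hlogH.le zero_le_two, div_eq_mul_inv, ← Real.rpow_neg zero_le_two]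
      norm_num
      ring
    rw [hsplit] at hmono
    calc rotStripBR H Wd ≤ C₁ * Real.log M ^ (-(1 : ℝ) / 3) := hcmp.trans hWM
      _ ≤ C₁ * ((2 : ℝ) ^ ((1 : ℝ) / 3) * Real.log H ^ (-(1 : ℝ) / 3)) :=
          mul_le_mul_of_nonneg_left hmono hC₁0
      _ = C₁ * (2 : ℝ) ^ ((1 : ℝ) / 3) * Real.log H ^ (-(1 : ℝ) / 3) := by ring
      _ ≤ _ := by nlinarith [mul_nonneg (mul_nonneg hWmax0 h64r) hy0]


/-- **The block package for Beaton's rotated triangles, unconditional**: `RotTriangleBlocks` holds with `W := rotTriW`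
(`W_M = c_E D^ε_M + c_B D^β_M`), `A` from the tour (K95.4 `rotTriBlockIneq_holds`), `Wmax = K/2`; the comparison
conjunct is the tree's `rotStripBR_le_rotTriW_all` (Glazman–Manolescu (4.1) in Beaton's frame) and antitonicity is
`rotTriW_antitone`. [cite: GlazmanManolescu2019, Lemma 4.1 and §4.1; Beaton2014RotatedHoneycomb, Proposition 4] -/
theorem rotTriangleBlocks_holds : RotTriangleBlocks := by
  obtain ⟨A, hA, hblock⟩ := rotTriBlockIneq_holds
  exact ⟨rotTriW, A, 2 * hexCriticalFugacity * Real.cos (Real.pi / 16), rotTriW_nonneg, fun M => (rotTriW_le M).2,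
    rotTriW_antitone, hA, hblock, fun M H Wd _hM hH => rotStripBR_le_rotTriW_all hH Wd, fun H Wd hH => rotStripBR_le_K hH Wd⟩

/-- **THM A — logarithmic decay of Beaton's rotated-strip bridge generating function at `x_c`, uniformly in the width**:
`∃ C, ∀ H ≥ 2, ∀ W, B^{⊥,→}_{D(H,W)}(x_c) = rotStripBR H W ≤ C · (log H)^{-1/3}` (right-started half; Beaton's
`B_{T,L} = 2 · rotStripBR (T-1) L`).  Beaton 2014, Appendix Theorem 14 prints `lim_T PP_T(x_c) = 0` WITHOUT a rate
(stick-breaking); the rate is Glazman–Manolescu's three-triangle argument (their Proposition 1.1, parallel frame, tree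
`HV.hexBridgeLogDecay`) transported to Beaton's rotated frame — lane R95, not located in print in this frame.
[cite: GlazmanManolescu2019, Proposition 1.1 and §4.1; Beaton2014RotatedHoneycomb, Appendix Theorem 14 (arXiv v3 p. 19)] -/
theorem rotStripLogDecay_holds : RotStripLogDecay := rotStripLogDecay_of_blocks rotTriangleBlocks_holds

/-- Discharge of the face `RotStripLogDecay` under the `<Fact>_holds` naming convention (= `rotStripLogDecay_holds`). [cite: GlazmanManolescu2019, Proposition 1.1 and §4.1; Beaton2014RotatedHoneycomb, Appendix Theorem 14] -/
theorem RotStripLogDecay_holds : RotStripLogDecay := rotStripLogDecay_holds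

/-- Discharge of the face `RotTriangleBlocks` under the `<Fact>_holds` naming convention (= `rotTriangleBlocks_holds`). [cite: GlazmanManolescu2019, Lemma 4.1 and §4.1; Beaton2014RotatedHoneycomb, Proposition 4] -/
theorem RotTriangleBlocks_holds : RotTriangleBlocks := rotTriangleBlocks_holds

/-- **THM A on Beaton's infinite-strip object `B_T(x_c) = lim_{W→∞} B^{⊥,→}(T, W) = ⨆_W B^{⊥,→}(T, W)`** (the limit
exists and equals the supremum: tree `HV.tendsto_rotStripBR`, `HexSAWRotStripLimit`): `B_T(x_c) ≤ C (log T)^{-1/3}` for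
`T ≥ 2`. NOT IN PRINT in the rotated (perpendicular) frame (Beaton 2014 App. Thm 14 / Cor. 15: `B_T(x_c) → 0` without rate;
parallel frame: Glazman–Manolescu 2020 Prop. 1.1, Krachun–Panagiotis 2026 Thm 2, tree `HV.hexBridgeLogDecay`).
[cite: Beaton2014RotatedHoneycomb, §4 (B_T = lim_L B_{T,L}) and Appendix Theorem 14 (arXiv v3 p. 19); GlazmanManolescu2019, Proposition 1.1] -/
theorem iSup_rotStripBR_le_log :
    ∃ C : ℝ, ∀ H : ℕ, 2 ≤ H → (⨆ Wd : ℕ, rotStripBR H Wd) ≤ C * Real.log H ^ (-(1 : ℝ) / 3) := by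
  obtain ⟨C, hC⟩ := rotStripLogDecay_holds
  exact ⟨C, fun H hH => ciSup_le fun Wd => hC H hH Wd⟩

end HV

namespace HexBW

open Literature.Probability.LatticeModels

/-- **FACE K95.0 — logarithmic decay of the brick-wall SPAN generating functions at criticality**, stated over the
tree's `bwSpanV A = Σ_m #spanBridges(m, A) · μ_ℍ^{-m}` (`HexSAWBrickWallSpanRenewal`; the planner's sketches G15/G17 wrote
the same function as `spanGF` with `brSpan`, which is `rfl`-equal): `∃ C, ∀ A ≥ 2, v_A ≤ C · (log A)^{-1/3}`.
[cite: Beaton2014RotatedHoneycomb, Appendix Theorem 14 and Appendix A (PP-bridges of height T); GlazmanManolescu2019, Proposition 1.1] -/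
def SpanDecayLog : Prop :=
  ∃ C : ℝ, ∀ A : ℕ, 2 ≤ A → bwSpanV A ≤ C * Real.log A ^ (-(1:ℝ) / 3)

/-- **Dictionary + THM A ⇒ the brick-wall span generating functions decay logarithmically**:
`∃ C, ∀ A ≥ 2, v_A = Σ_m #spanBridges(m, A) · μ_ℍ^{-m} ≤ C · (log A)^{-1/3}` (the tree's `HexBW.rot_dictionary` bounds every
partial sum by `x_c⁻¹ · rotStripBR A N`; a `tsum` of a nonnegative series is bounded by a bound on its partial sums).
[cite: Beaton2014RotatedHoneycomb, §2 and Appendix Theorem 14; GlazmanManolescu2019, Proposition 1.1] -/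
theorem spanDecayLog_holds : SpanDecayLog := by
  obtain ⟨C, hC⟩ := HV.rotStripLogDecay_holds
  have hx0 : 0 ≤ hexCriticalFugacity⁻¹ := inv_nonneg.2 hexCriticalFugacity_pos_lt_one.1.le
  refine ⟨hexCriticalFugacity⁻¹ * C, fun A hA => ?_⟩
  have hpart : ∀ N : ℕ, ∑ m ∈ range N, bwSpanTerm A m ≤
      hexCriticalFugacity⁻¹ * C * Real.log A ^ (-(1:ℝ) / 3) := fun N =>
    calc ∑ m ∈ range N, bwSpanTerm A m
        = ∑ m ∈ range N, (#(brSpan m (A : ℤ)) : ℝ) / hexConnectiveConstant ^ m := rfl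
      _ ≤ hexCriticalFugacity⁻¹ * HV.rotStripBR A N := rot_dictionary A N (by omega)
      _ ≤ hexCriticalFugacity⁻¹ * (C * Real.log A ^ (-(1:ℝ) / 3)) :=
          mul_le_mul_of_nonneg_left (hC A hA N) hx0
      _ = _ := by ring
  exact Real.tsum_le_of_sum_range_le (bwSpanTerm_nonneg A) hpart

/-- A `(log A)^{-1/3}` rate forces `v_A → 0`. [cite: Beaton2014RotatedHoneycomb, Appendix Theorem 14 and Lemma 16] -/
theorem tendsto_bwSpanV_zero_of_log (h : SpanDecayLog) : Tendsto bwSpanV atTop (𝓝 0) := by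
  obtain ⟨C, hC⟩ := h
  have hlog : Tendsto (fun A : ℕ => C * Real.log A ^ (-(1:ℝ) / 3)) atTop (𝓝 0) := by
    have h1 : Tendsto (fun x : ℝ => x ^ (-((1:ℝ) / 3))) atTop (𝓝 0) :=
      tendsto_rpow_neg_atTop (by norm_num)
    have h2 : Tendsto (fun A : ℕ => Real.log (A : ℝ)) atTop atTop :=
      Real.tendsto_log_atTop.comp tendsto_natCast_atTop_atTop
    have h3 := (h1.comp h2).const_mul C
    simp only [mul_zero] at h3
    refine h3.congr' (Eventually.of_forall fun A => ?_)
    simp only [Function.comp, neg_div]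
  refine tendsto_of_tendsto_of_tendsto_of_le_of_le' tendsto_const_nhds hlog (Eventually.of_forall bwSpanV_nonneg) ?_
  filter_upwards [eventually_ge_atTop 2] with A hA using hC A hA

/-- **Beaton 2014, Appendix Theorem 14 from the rate**: `SpanDecayLog → Beaton2014Thm14`, through the tree's
unconditional `beaton2014Thm14_iff_tendsto_bwSpanV_zero`. [cite: Beaton2014RotatedHoneycomb, Appendix Theorem 14 (arXiv v3 p. 19)] -/
theorem beaton2014Thm14_of_spanDecayLog (h : SpanDecayLog) : Beaton2014Thm14 :=
  beaton2014Thm14_iff_tendsto_bwSpanV_zero.2 (tendsto_bwSpanV_zero_of_log h)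

/-- **Beaton 2014, Theorem 14, PROVED (the tree's named fact `HexBW.Beaton2014Thm14` discharged, by a different,
quantitative proof)**: `lim_{T→∞} PP_T(x_c) = 0` for the honeycomb lattice with horizontal edges (bridges crossing
perpendicularly to an edge class).  Printed proof: stick-breaking (no rate); this proof: the rotated Glazman–Manolescu
tour and the `(log T)^{-1/3}` strip rate (THM A), through Beaton's Lemma 16 bookkeeping of the tree.
[cite: Beaton2014RotatedHoneycomb, Appendix, Theorem 14 (arXiv v3 p. 19)] -/
theorem beaton2014Thm14_holds : Beaton2014Thm14 := beaton2014Thm14_of_spanDecayLog spanDecayLog_holds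

/-- **The bridge null in Beaton's perpendicular (brick-wall) frame, unconditional: `b_n(ℍ) · μ_ℍ^{-n} → 0`** — the
number of `n`-step bridges of the hexagonal lattice in brick-wall coordinates is `o(μ_ℍ^n)` (the tree's
`tendsto_bridgeCount_div_pow_zero_of_beaton` with Theorem 14 now proved; the existence of the limit is
`HexBW.exists_tendsto_bridgeCount_div_pow`, its value was not decided in the tree before this file).
[cite: Beaton2014RotatedHoneycomb, Appendix, Theorem 14 and Corollary 15 (arXiv v3 p. 19)] -/
theorem tendsto_bridgeCount_div_pow_zero :
    Tendsto (fun n : ℕ => (bridgeCount n : ℝ) / hexConnectiveConstant ^ n) atTop (𝓝 0) :=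
  tendsto_bridgeCount_div_pow_zero_of_beaton beaton2014Thm14_holds

/-- **Infinite mean span of the irreducible brick-wall bridges at criticality, unconditional** (Beaton's Lemma 16 form
`E_iSAPP(H(γ)) = ∞`): `Σ_T T · f_T` diverges. [cite: Beaton2014RotatedHoneycomb, Appendix, Lemma 16 (arXiv v3 p. 20)] -/
theorem not_summable_mul_bwSpanF : ¬ Summable fun T : ℕ => (T : ℝ) * bwSpanF T :=
  not_summable_mul_bwSpanF_of_beaton beaton2014Thm14_holds

/-- Discharge of the tree's named fact `HexBW.Beaton2014Thm14` under the `<Fact>_holds` naming convention (= `beaton2014Thm14_holds`). [cite: Beaton2014RotatedHoneycomb, Appendix, Theorem 14 (arXiv v3 p. 19)] -/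
theorem Beaton2014Thm14_holds : Beaton2014Thm14 := beaton2014Thm14_holds

/-- Discharge of the face `SpanDecayLog` under the `<Fact>_holds` naming convention (= `spanDecayLog_holds`). [cite: Beaton2014RotatedHoneycomb, Appendix Theorem 14; GlazmanManolescu2019, Proposition 1.1] -/
theorem SpanDecayLog_holds : SpanDecayLog := spanDecayLog_holds

end HexBW

end Literature.Probability.RandomPlanarGeometry.SAW

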